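import Summits.CriticalPhenomena.PercolationContinuityZ3.Theorems.PercNearOneGluingNoHeavyLowerTailSahiLatinSlack
import Summits.CriticalPhenomena.PercolationContinuityZ3.Theorems.PercNearOneGluingNoHeavyLowerTailSahiLatinZeroDescent

/-!
# `NoHeavyLowerTail` (crux stmt-CriticalPhenomena-4575), Sahi programme (prim-master-conj gen 44): A-CLOSED triples of the Latin kernel —
# the support lemma `ess(b ∩ c) = ess(b) ∪ ess(c)`, the reduction of Conjecture TZ to "no fully dependent A-closed zero", and, under FBP,
# "A-closed zeros are terminal" from TZ — every dimension

Support file (`--supports stmt-CriticalPhenomena-4575`; companion of `…SahiLatinSlack`, `…SahiLatinIndep`, `…SahiLatinZeros`, `…SahiLatinZeroDescent`).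
Memo `run/shared/lean/prim/prim-l12/FROM-prim-master-conj-g44-*.md`; POINTWISE §45.  Everything proved; axioms standard; TZ / TZ′ are typed
`Prop`s, NEVER asserted; FBP (`LatinPos ι`) enters §4 only as a hypothesis.

A triple is A-CLOSED (`AClosed`) if it satisfies condition (C2) of `…SahiLatinDescent` in each slot: every maximal non-element of a slot
lies in the intersection of the other two (no A-move available).  Terminal ⟹ A-closed (`Terminal.aclosed`).
1. SUPPORT LEMMA (`axisInessential_of_inter`): if `b, c` are up-sets, every maximal non-element of `c` lies in `b`, and axis `i` is inessential
   for `b ∩ c`, then `i` is inessential for `c`.  Hence **at an A-closed triple `ess(b∩c) = ess(b) ∪ ess(c)`** (`AClosed.axisInessential_inter_iff`)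
   and `a ⊥ b∩c ⟺ a ⊥ b ∧ a ⊥ c` (`AClosed.indep_inter_iff`, all slots); `AClosed.HS_inter_eq_zero_iff`.
2. PAIRWISE INDEPENDENT TRIPLES ARE ZEROS (`kappa_eq_zero_of_indep_indep`; the Sahi cell's `sStarD_eq_zero_of_threeIndep` for `ι = Fin d`).
3. **TZ REDUCTION** (`indep_all_of_aclosed_zero_of_indep`): an A-closed up-set triple with `κ = 0` and ONE independent pair is pairwise
   independent (no properness, no FBP: `κ = HS(a∩c,b) + HS(a,b∩c)` by `…SahiLatinSlack.kappa_eq_of_indep`, both slacks vanish, then item 1).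
   CONJECTURE TZ′ (`AClosedZerosIndep`, typed): every A-closed zero with nonempty proper slots is pairwise independent; `TZ′ ⟹ TZ`
   (`terminalZerosIndep_of_aclosedZerosIndep`); **TZ ⟺ no fully dependent terminal zero** (`terminalZerosIndep_iff`), TZ′ likewise
   (`aclosedZerosIndep_iff`).  Evidence for TZ′: `d = 3` exhaustive (the 40 266 A-closed proper ordered triples of `[3]³` contain exactly the
   48 pairwise independent zeros; min `κ` = 4 among dependent, 8 among fully dependent ones), `d = 4,5,6` sampled (memo).
4. UNDER FBP: R-moves preserve A-closedness (`AClosed.erase_left`), a reverse R-move out of a triple with an independent pair is never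
   cost-free (`Phi_ne_zero_of_isMaxOut_of_indep`, no FBP), hence **`terminal_of_aclosed_zero`: FBP ∧ TZ ⟹ every A-closed zero with nonempty
   proper slots is terminal** and `aclosedZerosIndep_of_latinPos : FBP ∧ TZ ⟹ TZ′`.
HONEST LABEL: TZ, TZ′ and FBP (`d ≥ 5`) are OPEN.
-/

namespace Summit.CriticalPhenomena.PercolationContinuityZ3.Theorems.SahiLatin

open Finset

variable {ι : Type*} [Fintype ι] [DecidableEq ι]

/-! ## §1  Inessential axes of intersections; the support lemma -/

/-- An axis inessential for `b` and for `c` is inessential for `b ∩ c`. [this work] -/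
theorem axisInessential_inter {b c : Finset (Pt ι)} {i : ι} (hb : AxisInessential b i) (hc : AxisInessential c i) :
    AxisInessential (b ∩ c) i := fun x v => by
  rw [mem_inter, mem_inter, hb x v, hc x v]

/-- Independence passes to intersections: `a ⊥ b`, `a ⊥ c ⟹ a ⊥ b ∩ c`. [this work] -/
theorem Indep.inter_right {a b c : Finset (Pt ι)} (hab : Indep a b) (hac : Indep a c) : Indep a (b ∩ c) := fun i => by
  rcases hab i with h | h
  · exact Or.inl h
  · rcases hac i with h' | h'
    · exact Or.inl h'
    · exact Or.inr (axisInessential_inter h h')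

/-- Above every non-element of `c` there is a maximal non-element of `c`. [this work] -/
theorem exists_isMaxOut_ge {c : Finset (Pt ι)} {x : Pt ι} (hx : x ∉ c) : ∃ m, IsMaxOut c m ∧ x ≤ m := by
  classical
  obtain ⟨m, hxm, hm⟩ := (univ.filter fun y : Pt ι => y ∉ c).exists_le_maximal (mem_filter.2 ⟨mem_univ _, hx⟩)
  refine ⟨m, ⟨(mem_filter.1 hm.1).2, fun y hmy hym => ?_⟩, hxm⟩
  by_contra hyc
  exact hym (le_antisymm (hm.2 (mem_filter.2 ⟨mem_univ _, hyc⟩) hmy) hmy)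

/-- **SUPPORT LEMMA.**  If `b, c` are up-sets, every maximal non-element of `c` lies in `b`, and axis `i` is inessential for `b ∩ c`, then
`i` is inessential for `c`. [this work] -/
theorem axisInessential_of_inter {b c : Finset (Pt ι)} (hb : IsUpperSet (b : Set (Pt ι))) (hc : IsUpperSet (c : Set (Pt ι)))
    (hC2 : ∀ m, IsMaxOut c m → m ∈ b) {i : ι} (h : AxisInessential (b ∩ c) i) : AxisInessential c i := by
  by_contra hne
  obtain ⟨p, hp0, hp2⟩ := exists_jump_of_not_axisInessential hc hne
  obtain ⟨m, hm, hpm⟩ := exists_isMaxOut_ge hp0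
  have hmb : m ∈ b := hC2 m hm
  -- raise the `i`-th coordinate of `m` to the top
  have hle : m ≤ Function.update m i 2 := fun j => by
    by_cases hji : j = i
    · subst hji
      rw [Function.update_self]
      exact Fin.le_iff_val_le_val.2 (by have := (m j).isLt; simp only [Fin.val_two]; omega)
    · rw [Function.update_of_ne hji]
  have hm2b : Function.update m i 2 ∈ b := hb hle hmb
  have hp2le : Function.update p i 2 ≤ Function.update m i 2 := fun j => by
    by_cases hji : j = i
    · subst hji; rw [Function.update_self, Function.update_self]
    · rw [Function.update_of_ne hji, Function.update_of_ne hji]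
      have := hpm j
      rwa [Function.update_of_ne hji] at this
  have hm2c : Function.update m i 2 ∈ c := hc hp2le hp2
  have hm2 : Function.update m i 2 ∈ b ∩ c := mem_inter.2 ⟨hm2b, hm2c⟩
  -- inessentiality of `i` for `b ∩ c` brings `m` itself into `b ∩ c`
  have hm' : Function.update (Function.update m i 2) i (m i) ∈ b ∩ c := (h _ (m i)).2 hm2
  rw [Function.update_idem, Function.update_eq_self] at hm'
  exact hm.1 (mem_inter.1 hm').2

/-- The support lemma for a pair satisfying (C2) towards each other: `ess(b ∩ c) = ess(b) ∪ ess(c)`, as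
`i ∉ ess(b∩c) ⟺ i ∉ ess(b) ∧ i ∉ ess(c)`. [this work] -/
theorem axisInessential_inter_iff_of_C2 {b c : Finset (Pt ι)} (hb : IsUpperSet (b : Set (Pt ι))) (hc : IsUpperSet (c : Set (Pt ι)))
    (hcb : ∀ m, IsMaxOut c m → m ∈ b) (hbc : ∀ m, IsMaxOut b m → m ∈ c) (i : ι) :
    AxisInessential (b ∩ c) i ↔ AxisInessential b i ∧ AxisInessential c i := by
  refine ⟨fun h => ⟨?_, axisInessential_of_inter hb hc hcb h⟩, fun h => axisInessential_inter h.1 h.2⟩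
  rw [inter_comm] at h
  exact axisInessential_of_inter hc hb hbc h

/-! ## §2  A-closed triples: slot symmetries; supports of the pairwise intersections -/

/-- An A-CLOSED triple: condition (C2) in each slot (no A-move available) — every maximal non-element of a slot lies in the intersection
of the other two. [this work] -/
structure AClosed (a b c : Finset (Pt ι)) : Prop where
  /-- (C2) for `a`. -/
  c2a : C2 a b c
  /-- (C2) for `b`. -/
  c2b : C2 b a c
  /-- (C2) for `c`. -/
  c2c : C2 c a b

omit [Fintype ι] [DecidableEq ι] in
/-- Terminal triples are A-closed. [this work] -/
theorem Terminal.aclosed {a b c : Finset (Pt ι)} (h : Terminal a b c) : AClosed a b c := ⟨h.c2a, h.c2b, h.c2c⟩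

omit [Fintype ι] [DecidableEq ι] in
/-- (C2) is symmetric in the two reference sets. [this work] -/
theorem C2.symm {s t u : Finset (Pt ι)} (h : C2 s t u) : C2 s u t := fun m hm => ⟨(h m hm).2, (h m hm).1⟩

omit [Fintype ι] [DecidableEq ι] in
/-- A-closedness is invariant under swapping the last two slots. [this work] -/
theorem AClosed.swap23 {a b c : Finset (Pt ι)} (h : AClosed a b c) : AClosed a c b := ⟨h.c2a.symm, h.c2c, h.c2b⟩

omit [Fintype ι] [DecidableEq ι] in
/-- A-closedness is invariant under swapping the first two slots. [this work] -/
theorem AClosed.swap12 {a b c : Finset (Pt ι)} (h : AClosed a b c) : AClosed b a c := ⟨h.c2b, h.c2a, h.c2c.symm⟩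

omit [Fintype ι] [DecidableEq ι] in
/-- Terminality is invariant under swapping the last two slots. [this work] -/
theorem Terminal.swap23 {a b c : Finset (Pt ι)} (h : Terminal a b c) : Terminal a c b where
  c1a := h.c1a.symm
  c1b := h.c1c
  c1c := h.c1b
  c2a := h.c2a.symm
  c2b := h.c2c
  c2c := h.c2b

omit [Fintype ι] [DecidableEq ι] in
/-- Terminality is invariant under swapping the first two slots. [this work] -/
theorem Terminal.swap12 {a b c : Finset (Pt ι)} (h : Terminal a b c) : Terminal b a c where
  c1a := h.c1b
  c1b := h.c1a
  c1c := h.c1c.symm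
  c2a := h.c2b
  c2b := h.c2a
  c2c := h.c2c.symm

omit [Fintype ι] [DecidableEq ι] in
/-- `UpTriple` is invariant under swapping the last two slots. [this work] -/
theorem UpTriple.swap23 {a b c : Finset (Pt ι)} (h : UpTriple a b c) : UpTriple a c b := ⟨h.1, h.2.2, h.2.1⟩

omit [Fintype ι] [DecidableEq ι] in
/-- `UpTriple` is invariant under swapping the first two slots. [this work] -/
theorem UpTriple.swap12 {a b c : Finset (Pt ι)} (h : UpTriple a b c) : UpTriple b a c := ⟨h.2.1, h.1, h.2.2⟩

/-- **AT AN A-CLOSED TRIPLE `ess(b ∩ c) = ess(b) ∪ ess(c)`** (slot `a`'s partners; up-sets, no properness needed). [this work] -/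
theorem AClosed.axisInessential_inter_iff {a b c : Finset (Pt ι)} (hup : UpTriple a b c) (hA : AClosed a b c) (i : ι) :
    AxisInessential (b ∩ c) i ↔ AxisInessential b i ∧ AxisInessential c i :=
  axisInessential_inter_iff_of_C2 hup.2.1 hup.2.2 (fun m hm => (hA.c2c m hm).2) (fun m hm => (hA.c2b m hm).2) i

/-- **At an A-closed triple `a ⊥ b ∩ c ⟺ a ⊥ b ∧ a ⊥ c`.** [this work] -/
theorem AClosed.indep_inter_iff {a b c : Finset (Pt ι)} (hup : UpTriple a b c) (hA : AClosed a b c) :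
    Indep a (b ∩ c) ↔ Indep a b ∧ Indep a c := by
  refine ⟨fun h => ⟨fun i => ?_, fun i => ?_⟩, fun h => h.1.inter_right h.2⟩
  · rcases h i with h' | h'
    · exact Or.inl h'
    · exact Or.inr ((hA.axisInessential_inter_iff hup i).1 h').1
  · rcases h i with h' | h'
    · exact Or.inl h'
    · exact Or.inr ((hA.axisInessential_inter_iff hup i).1 h').2

/-- Slot `b`: at an A-closed triple `b ⊥ a ∩ c ⟺ b ⊥ a ∧ b ⊥ c`. [this work] -/
theorem AClosed.indep_inter_iff₂ {a b c : Finset (Pt ι)} (hup : UpTriple a b c) (hA : AClosed a b c) :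
    Indep b (a ∩ c) ↔ Indep b a ∧ Indep b c :=
  hA.swap12.indep_inter_iff hup.swap12

/-- Slot `c`: at an A-closed triple `c ⊥ a ∩ b ⟺ c ⊥ a ∧ c ⊥ b`. [this work] -/
theorem AClosed.indep_inter_iff₃ {a b c : Finset (Pt ι)} (hup : UpTriple a b c) (hA : AClosed a b c) :
    Indep c (a ∩ b) ↔ Indep c a ∧ Indep c b :=
  (hA.swap23.swap12).indep_inter_iff (hup.swap23.swap12)

/-- At an A-closed triple the mixed slack `HS(a, b∩c)` vanishes iff `a ⊥ b` and `a ⊥ c`. [this work] -/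
theorem AClosed.HS_inter_eq_zero_iff {a b c : Finset (Pt ι)} (hup : UpTriple a b c) (hA : AClosed a b c) :
    HS a (b ∩ c) = 0 ↔ Indep a b ∧ Indep a c := by
  have hbc : IsUpperSet ((b ∩ c : Finset (Pt ι)) : Set (Pt ι)) := by rw [coe_inter]; exact hup.2.1.inter hup.2.2
  rw [HS_eq_zero_iff_indep hup.1 hbc, hA.indep_inter_iff hup]

/-- Terminal version of the support lemma. [this work] -/
theorem Terminal.indep_inter_iff {a b c : Finset (Pt ι)} (hup : UpTriple a b c) (hT : Terminal a b c) :
    Indep a (b ∩ c) ↔ Indep a b ∧ Indep a c :=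
  hT.aclosed.indep_inter_iff hup

/-! ## §3  Pairwise independent triples are zeros; the TZ reduction; TZ′ -/

/-- **Pairwise independent triples are zeros of the kernel** (any finite sets; all `d`). [this work] -/
theorem kappa_eq_zero_of_indep_indep {a b c : Finset (Pt ι)} (hab : Indep a b) (hac : Indep a c) (hbc : Indep b c) : kappa a b c = 0 := by
  have h1 : HS (a ∩ c) b = 0 := HS_eq_zero_of_indep (hab.symm.inter_right hbc).symm
  have h2 : HS a (b ∩ c) = 0 := HS_eq_zero_of_indep (hab.inter_right hac)
  rw [kappa_eq_of_indep hab, h1, h2, add_zero]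

/-- The pairwise independent triples of nonempty proper up-sets are terminal zeros (`terminal_of_indep` + the above). [this work] -/
theorem terminal_zero_of_indep_indep {a b c : Finset (Pt ι)} (hup : UpTriple a b c)
    (ha : a.Nonempty) (ha' : a ≠ univ) (hb : b.Nonempty) (hb' : b ≠ univ) (hc : c.Nonempty) (hc' : c ≠ univ)
    (hab : Indep a b) (hac : Indep a c) (hbc : Indep b c) : Terminal a b c ∧ kappa a b c = 0 :=
  ⟨terminal_of_indep hup ha ha' hb hb' hc hc' hab hac hbc, kappa_eq_zero_of_indep_indep hab hac hbc⟩

/-- **TZ REDUCTION, main case**: an A-closed up-set triple with `κ = 0` and `a ⊥ b` is pairwise independent. [this work] -/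
theorem indep_all_of_aclosed_zero_of_indep {a b c : Finset (Pt ι)} (hup : UpTriple a b c) (hA : AClosed a b c) (h0 : kappa a b c = 0)
    (hab : Indep a b) : Indep a c ∧ Indep b c := by
  obtain ⟨h1, h2⟩ := indep_inter_of_indep_of_kappa_eq_zero hup hab h0
  exact ⟨((hA.indep_inter_iff hup).1 h2).2, ((hA.indep_inter_iff₂ hup).1 h1.symm).2⟩

/-- **TZ REDUCTION**: an A-closed up-set triple with `κ = 0` and an independent pair is pairwise independent. [this work] -/
theorem indep_all_of_aclosed_zero_of_indepPair {a b c : Finset (Pt ι)} (hup : UpTriple a b c) (hA : AClosed a b c)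
    (h0 : kappa a b c = 0) (h : Indep a b ∨ Indep a c ∨ Indep b c) : Indep a b ∧ Indep a c ∧ Indep b c := by
  rcases h with hab | hac | hbc
  · exact ⟨hab, indep_all_of_aclosed_zero_of_indep hup hA h0 hab⟩
  · have h0' : kappa a c b = 0 := by rw [← kappa_swap23]; exact h0
    obtain ⟨hab, hcb⟩ := indep_all_of_aclosed_zero_of_indep hup.swap23 hA.swap23 h0' hac
    exact ⟨hab, hac, hcb.symm⟩
  · have h0' : kappa b c a = 0 := by rw [kappa_swap23, ← kappa_swap12]; exact h0
    obtain ⟨hba, hca⟩ := indep_all_of_aclosed_zero_of_indep (hup.swap12.swap23) (hA.swap12.swap23) h0' hbc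
    exact ⟨hba.symm, hca.symm, hbc⟩

/-- Terminal version of the reduction. [this work] -/
theorem indep_all_of_terminal_zero_of_indepPair {a b c : Finset (Pt ι)} (hup : UpTriple a b c) (hT : Terminal a b c)
    (h0 : kappa a b c = 0) (h : Indep a b ∨ Indep a c ∨ Indep b c) : Indep a b ∧ Indep a c ∧ Indep b c :=
  indep_all_of_aclosed_zero_of_indepPair hup hT.aclosed h0 h

/-- **CONJECTURE TZ′** (prim-master-conj gen 44; typed as a `Prop`, NEVER asserted): every A-CLOSED triple of nonempty proper up-sets of
`[3]^ι` with `κ = 0` is pairwise independent.  Implies TZ.  Evidence: `d = 3` exhaustive, `d = 4, 5, 6` sampled (A-closures of random zeros).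
An obligation / hypothesis, never a fact. [this work] [status: open] -/
@[conjecture] def AClosedZerosIndep (ι : Type*) [Fintype ι] [DecidableEq ι] : Prop :=
  ∀ a b c : Finset (Pt ι), UpTriple a b c → a.Nonempty → a ≠ univ → b.Nonempty → b ≠ univ → c.Nonempty → c ≠ univ →
    AClosed a b c → kappa a b c = 0 → Indep a b ∧ Indep a c ∧ Indep b c

/-- TZ′ ⟹ TZ. [this work] -/
theorem terminalZerosIndep_of_aclosedZerosIndep (h : AClosedZerosIndep ι) : TerminalZerosIndep ι :=
  fun a b c hup ha ha' hb hb' hc hc' hT h0 => h a b c hup ha ha' hb hb' hc hc' hT.aclosed h0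

/-- **TZ ⟺ NO FULLY DEPENDENT TERMINAL ZERO**: Conjecture TZ holds iff every terminal triple of nonempty proper up-sets with `κ = 0` has an
independent pair. [this work] -/
theorem terminalZerosIndep_iff : TerminalZerosIndep ι ↔
    ∀ a b c : Finset (Pt ι), UpTriple a b c → a.Nonempty → a ≠ univ → b.Nonempty → b ≠ univ → c.Nonempty → c ≠ univ →
      Terminal a b c → kappa a b c = 0 → (Indep a b ∨ Indep a c ∨ Indep b c) := by
  constructor
  · intro h a b c hup ha ha' hb hb' hc hc' hT h0
    exact Or.inl (h a b c hup ha ha' hb hb' hc hc' hT h0).1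
  · intro h a b c hup ha ha' hb hb' hc hc' hT h0
    exact indep_all_of_terminal_zero_of_indepPair hup hT h0 (h a b c hup ha ha' hb hb' hc hc' hT h0)

/-- **TZ′ ⟺ NO FULLY DEPENDENT A-CLOSED ZERO.** [this work] -/
theorem aclosedZerosIndep_iff : AClosedZerosIndep ι ↔
    ∀ a b c : Finset (Pt ι), UpTriple a b c → a.Nonempty → a ≠ univ → b.Nonempty → b ≠ univ → c.Nonempty → c ≠ univ →
      AClosed a b c → kappa a b c = 0 → (Indep a b ∨ Indep a c ∨ Indep b c) := by
  constructor
  · intro h a b c hup ha ha' hb hb' hc hc' hA h0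
    exact Or.inl (h a b c hup ha ha' hb hb' hc hc' hA h0).1
  · intro h a b c hup ha ha' hb hb' hc hc' hA h0
    exact indep_all_of_aclosed_zero_of_indepPair hup hA h0 (h a b c hup ha ha' hb hb' hc hc' hA h0)

/-! ## §4  Under FBP: R-moves preserve A-closedness; reverse R-moves out of an independent pair cost; TZ ⟹ TZ′ -/

/-- **A reverse R-move out of a triple with `a ⊥ b` is never cost-free**: if `m` is a maximal non-element of `a`, `a ⊥ b`, `b` is a proper
up-set and `m ∈ b ∩ c`, then `Φ_{bc}(m) ≠ 0` (indeed `> 0` by Lemma R).  (Otherwise the whole link of `m` lies in `b`; its bottom point has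
level `0` on every `a`-inessential axis, where `m` has level `2`; `b` only sees those axes, so `(0,…,0) ∈ b`.) [this work] -/
theorem Phi_ne_zero_of_isMaxOut_of_indep {a b c : Finset (Pt ι)} {m : Pt ι} (hm : IsMaxOut a m) (hab : Indep a b)
    (hb : IsUpperSet (b : Set (Pt ι))) (hbU : b ≠ univ) (hmb : m ∈ b) (hmc : m ∈ c) : Phi b c m ≠ 0 := by
  intro h0
  have hlink := (Phi_eq_zero_iff_of_mem hmb hmc).1 h0
  have hy : ofSet m ∅ ∈ b := (hlink _ (ofSet_mem_link m ∅)).1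
  refine hbU (eq_univ_of_bot_mem hb ((mem_iff_mem_of_agree (s := b) (x := ofSet m ∅) (y := fun _ => (0 : Fin 3)) fun i => ?_).1 hy))
  rcases hab i with h | h
  · left
    have h2 : m i = 2 := hm.apply_eq_two h
    simp only [ofSet, Finset.notMem_empty, if_false, h2]
    decide
  · exact Or.inr h

omit [DecidableEq ι] in
/-- **R-moves preserve A-closedness**: removing from `a` a minimal element lying in `b ∩ c` keeps (C2) in all three slots. [this work] -/
theorem AClosed.erase_left {a b c : Finset (Pt ι)} (hA : AClosed a b c) {m : Pt ι} (hm : IsMinOf a m) (hmb : m ∈ b) (hmc : m ∈ c) :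
    AClosed (a.erase m) b c where
  c2a := fun x hx => by
    by_cases hxm : x = m
    · subst hxm; exact ⟨hmb, hmc⟩
    · refine hA.c2a x ⟨fun hxa => hx.1 (mem_erase.2 ⟨hxm, hxa⟩), fun y hxy hyx => ?_⟩
      exact (mem_erase.1 (hx.2 y hxy hyx)).2
  c2b := fun x hx => by
    obtain ⟨hxa, hxc⟩ := hA.c2b x hx
    exact ⟨mem_erase.2 ⟨fun hxm => hx.1 (hxm ▸ hmb), hxa⟩, hxc⟩
  c2c := fun x hx => by
    obtain ⟨hxa, hxb⟩ := hA.c2c x hx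
    exact ⟨mem_erase.2 ⟨fun hxm => hx.1 (hxm ▸ hmc), hxa⟩, hxb⟩

omit [Fintype ι] [DecidableEq ι] in
/-- A non-terminal A-closed triple admits an R-move in some slot. [this work] -/
theorem AClosed.exists_rmove_of_not_terminal {a b c : Finset (Pt ι)} (hA : AClosed a b c) (hT : ¬ Terminal a b c) :
    (∃ m, IsMinOf a m ∧ m ∈ b ∧ m ∈ c) ∨ (∃ m, IsMinOf b m ∧ m ∈ a ∧ m ∈ c) ∨ (∃ m, IsMinOf c m ∧ m ∈ a ∧ m ∈ b) := by
  by_contra h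
  simp only [not_or, not_exists, not_and] at h
  obtain ⟨h1, h2, h3⟩ := h
  exact hT ⟨fun m hm hmem => h1 m hm hmem.1 hmem.2, fun m hm hmem => h2 m hm hmem.1 hmem.2,
    fun m hm hmem => h3 m hm hmem.1 hmem.2, hA.c2a, hA.c2b, hA.c2c⟩

/-- An empty slot of an A-closed triple forces the other two to be `⊤` (so a slot of an A-closed triple with proper partners is nonempty). [this work] -/
theorem AClosed.nonempty_left {a b c : Finset (Pt ι)} (hA : AClosed a b c) (hbU : b ≠ univ) : a.Nonempty := by
  rw [nonempty_iff_ne_empty]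
  rintro rfl
  exact hbU (eq_univ_of_C2_empty hA.c2b)

/-- The slot-`a` step of `terminal_of_aclosed_zero`: at an A-closed zero with nonempty proper slots, an R-move in slot `a` whose result is
pairwise independent is impossible (under FBP the move is cost-free, `Phi_eq_zero_of_isMinOf`; but out of an independent pair it costs,
`Phi_ne_zero_of_isMaxOut_of_indep`). [this work] -/
theorem false_of_rmove_to_indep (hL : LatinPos ι) {a b c : Finset (Pt ι)} (hup : UpTriple a b c) (h0 : kappa a b c = 0)
    (hbU : b ≠ univ) {m : Pt ι} (hm : IsMinOf a m) (hmb : m ∈ b) (hmc : m ∈ c) (hind : Indep (a.erase m) b) : False := by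
  have hΦ : Phi b c m = 0 := (Phi_eq_zero_of_isMinOf hL hup h0 hm hmb hmc).1
  have hmax : IsMaxOut (a.erase m) m :=
    ⟨notMem_erase m a, fun y hmy hym => mem_erase.2 ⟨hym, hup.1 hmy hm.1⟩⟩
  exact Phi_ne_zero_of_isMaxOut_of_indep hmax hind hup.2.1 hbU hmb hmc hΦ

/-- **UNDER FBP AND TZ, EVERY A-CLOSED ZERO WITH NONEMPTY PROPER SLOTS IS TERMINAL** (and hence pairwise independent).  Induction on
`|a|+|b|+|c|`: an available R-move is cost-free and keeps A-closedness and properness, so its result is terminal by induction and pairwise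
independent by TZ — contradicting `false_of_rmove_to_indep`. [this work] -/
theorem terminal_of_aclosed_zero (hL : LatinPos ι) (hTZ : TerminalZerosIndep ι) :
    ∀ (n : ℕ) (a b c : Finset (Pt ι)), a.card + b.card + c.card = n → UpTriple a b c → a ≠ univ → b ≠ univ → c ≠ univ →
      AClosed a b c → kappa a b c = 0 → Terminal a b c := by
  intro n
  induction n using Nat.strong_induction_on with
  | _ n ih =>
    intro a b c hn hup haU hbU hcU hA h0
    by_contra hT
    -- the generic slot-`a` argument, to be applied to the three slot permutations
    have key : ∀ (a b c : Finset (Pt ι)), a.card + b.card + c.card = n → UpTriple a b c → a ≠ univ → b ≠ univ → c ≠ univ →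
        AClosed a b c → kappa a b c = 0 → ∀ m, IsMinOf a m → m ∈ b → m ∈ c → False := by
      intro a b c hn hup haU hbU hcU hA h0 m hm hmb hmc
      have hup' : UpTriple (a.erase m) b c := ⟨isUpperSet_erase_of_minimal hup.1 hm.2, hup.2.1, hup.2.2⟩
      have hA' : AClosed (a.erase m) b c := hA.erase_left hm hmb hmc
      have h0' : kappa (a.erase m) b c = 0 := (Phi_eq_zero_of_isMinOf hL hup h0 hm hmb hmc).2
      have haU' : a.erase m ≠ univ := fun h => haU (eq_univ_of_forall fun x => mem_of_mem_erase (h.symm ▸ mem_univ x))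
      have hlt : (a.erase m).card + b.card + c.card < n := by
        have := card_erase_lt_of_mem hm.1; omega
      have hT' : Terminal (a.erase m) b c := ih _ hlt (a.erase m) b c rfl hup' haU' hbU hcU hA' h0'
      have hne : (a.erase m).Nonempty := hA'.nonempty_left hbU
      have hbne : b.Nonempty := hA'.swap12.nonempty_left haU'
      have hcne : c.Nonempty := (hA'.swap23.swap12).nonempty_left haU'
      have hind := hTZ _ _ _ hup' hne haU' hbne hbU hcne hcU hT' h0'
      exact false_of_rmove_to_indep hL hup h0 hbU hm hmb hmc hind.1
    rcases hA.exists_rmove_of_not_terminal hT with ⟨m, hm, hmb, hmc⟩ | ⟨m, hm, hma, hmc⟩ | ⟨m, hm, hma, hmb⟩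
    · exact key a b c hn hup haU hbU hcU hA h0 m hm hmb hmc
    · refine key b a c (by omega) hup.swap12 hbU haU hcU hA.swap12 ?_ m hm hma hmc
      rw [kappa_swap12]; exact h0
    · refine key c a b (by omega) (hup.swap23.swap12) hcU haU hbU (hA.swap23.swap12) ?_ m hm hma hmb
      rw [kappa_swap12, kappa_swap23]; exact h0

/-- **FBP ∧ TZ ⟹ TZ′**: under FBP, Conjecture TZ already gives the pairwise independence of every A-closed zero with nonempty proper slots.
[this work] -/
theorem aclosedZerosIndep_of_latinPos (hL : LatinPos ι) (hTZ : TerminalZerosIndep ι) : AClosedZerosIndep ι :=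
  fun a b c hup ha ha' hb hb' hc hc' hA h0 =>
    hTZ a b c hup ha ha' hb hb' hc hc' (terminal_of_aclosed_zero hL hTZ _ a b c rfl hup ha' hb' hc' hA h0) h0

end Summit.CriticalPhenomena.PercolationContinuityZ3.Theorems.SahiLatin
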